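import Summits.QuantumFields.YangMills.Theorems.UnitScaleTiltProp8ChartCovariance
import Summits.QuantumFields.Balaban3D.Carriers.RadialContour
import Literature.MathematicalPhysics.QuantumFieldTheory.Balaban1983to89.BlockAveragingEMLLinearised
import Literature.MathematicalPhysics.QuantumFieldTheory.Balaban1983to89.BlockAveragingFederbush
import HarnessLib

/-!
# N07 [B11] (= [15]) Sect. F — [I] (0.11)'s «EUCLIDEAN INVARIANT» AVERAGED CONTOUR VARIABLES AS A `Setup.ContourData` ON THE TORUS:
# `𝐔(y, x) = M({U(Γ^σ_{y,x})}_σ)` (the group average `M` of the `d!` staircase transporters of [I] (0.3) from the block centre), gauge covariant by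
# (0.6) — MODULE 86 = the FIRST BRICK of cure (α″) of ⚑ LOCATED-CPRIME-CURRENCY (plan g91 RULING A3‴, 2026-08-29)

Cell `pub-ymgap`, seat `pub-ymgap-dag-n07-e` g27 (FAN-OUT §N07 row s3; LANE OWNER of the K0 road), MODULE 86 (INTENT-86, cell bus).
`--kind definition --supports stmt-QuantumFields-20541 --as helper` (K0⁷); count-neutral.  THREE small `def`s (an enumeration of the stair orders, the stair family, the
contour datum) + bookkeeping theorems; nothing landed is edited.  [I] = [Balaban1987RG1]; [3] = [Balaban1985Averaging]; [15] = [Balaban1985Variational].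

WHY (⚑ LOCATED-CPRIME-CURRENCY, desk memo `LOCATED-CPRIME-CURRENCY.md` §5 (α″); plan RULING A3‴).  The record's block averaging `avOfRecord` is [I]'s SYMMETRISED (0.4) (all stair
orders `σ`); the normalisation layer of the head (60′ `NrmOfRecordWide`, the (85)∕(88) frames of `Node00/ShearedAveragingFlat`) was instantiated at the ONE-PATH contour datum
`radialContourData` ([4] (1.7)).  The two differ at FIRST order by in-block curvature fluxes, and the (c′) letter of the K0 road sits exactly on that seam.  Print's own remedy is
[I] p. 253, verbatim: «We need also a Euclidean invariant definition of the axial gauge fixing. A natural idea, in agreement with the above definition, would be to use variables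
obtained by averaging the contour variables {U(Γ)}_{Γ∈G(y,x)}, rather than to use one contour variable U(Γ_{y,x}). … (0.11) U(y,x) = M({U(Γ)}_{Γ∈G(y,x)})», `M` a group average
with (0.5)–(0.7), e.g. Federbush's (0.10) — the tree's `Setup.GroupAverage` (axioms on `FamilySmall δ` families) with the inhabitant `FederbushMean.federbushSU`.
`Setup.ContourData`'s own docstring names (0.11) as its intended reading.  THIS FILE types (0.11) on the torus `T^{(j)}` for ANY `GroupAverage 𝓜` of any gauge group, as a
`Setup.ContourData` — so that `Node00/ShearedAveragingFlat` ((78)–(88), generic in the contour datum) applies to it verbatim — and records its centre value and its agreement with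
the radial datum off the guard.

THE GUARD.  `Setup.GroupAverage`'s axioms hold only on `FamilySmall 𝓜.δ` families (as printed: «sets … with sufficiently small diameters»), while `ContourData.covariant` is an
identity for ALL fields.  The datum is therefore GUARDED: at a block site `x = blockSite y r` (standing range `j + 1 ≤ m + K`) whose stair family `{U(Γ^σ_{y,x})}_σ` is
`𝓜.δ`-small it is `𝓜.M` of that family; otherwise (large family, `x ∉ B(y)`, or junk levels) it falls back to the radial transporter `radialHol U y x`.  The guard is GAUGE
INVARIANT (`U ↦ U^u` conjugates every `U(Γ^σ_{y,x})·U(Γ^τ_{y,x})⁻¹` by `u(emb y)`, and `dist1` is conjugation invariant), so both branches transform alike and covariance is exact.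
In every use (small fields, [15] (152)) the guard holds and the datum IS (0.11).

WHAT IS DEFINED ∕ PROVED (sorry-free; axioms standard).
* §1 `permEnum P` — an enumeration `Fin ((d! − 1) + 1) ≃ Equiv.Perm (Fin d)` of the stair orders; `stairFamily U y r` — the family `σ ↦ U(Γ^σ_{y, blockSite y r})` (transport `holT`
  along `stairWord σ (off r)` from `emb y`); `stairFamily_gaugeAct` (every member is conjugated∕translated alike: `u(emb y) · _ · u(x)⁻¹`); `familySmall_stairFamily_gaugeAct_iff`.
* §2 `symContourData 𝓜 : ContourData P j G` — (0.11), guarded as above; `symContourData_holTo_of_small` (the (0.11) branch), `symContourData_holTo_of_not_mem` ∕ `_of_not_small`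
  ∕ `_of_not_range` (the fallback), `symContourData_holTo_emb` (centre value `𝓜.M (const 1)`; `= 1` for any `𝓜` with `M(const g) = g`, e.g. `federbushSU_const` — the `hctr` of `ShearedAveragingFlat`).
* §3 the `SU(N)` instance of record is `symContourData FederbushMean.federbushSU` (radius `min(1∕100, 1∕(3N))`); `off_blockEquiv_emb`, `stairFamily_emb` and
  `symContourData_federbushSU_holTo_emb` record its centre value `1` (`hctr`).
* §4 `stairFamily_one`, `symContourData_holTo_one`, `axialGauge_symContourData_one` — the unit configuration is `symContourData`-axial (A6 material).
HONEST SCOPE: a contour datum and its bookkeeping; NO estimate of [15]∕[6]∕[3]∕[I]; nothing of the head, of 60′, of `HThm4Rec` is touched here (their (α″) editions follow as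
separate modules); K0⁷ ∕ K1⁹ NOT closed; N07 NOT discharged; counts unmoved (typed 28∕28 · discharged 8∕27); one finite 𝕋⁴ programme at fixed ε — the route closes the conditional
finite-𝕋⁴ rung `BalabanLadder.UV` ONLY; the YM mass gap (Clay) is NOT proved by any of this; nothing continuum ∕ ℝ⁴ ∕ OS.  No `instance`, no `notation`, no `sorry`.

References: [I] (0.3) p. 252, (0.5)–(0.11) p. 253; [3] (9), (11) pp. 18–19, (78)–(88) pp. 30–31; [4] = [Balaban1984PropagatorsI] (1.7) p. 18; [15] (147)–(154) pp. 301–302.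
-/

set_option autoImplicit false

noncomputable section

namespace Summit.QuantumFields.YangMills.BalabanUVNodes.N07SymContourData

open Literature.MathematicalPhysics.QuantumFieldTheory.Balaban1983to89
open T4Continuum (walkEnd stairWord)
open BlockAveraging (off)
open B10Eq27TorusAxialLog (holT gaugeActT gaugeActT_eq_gaugeAct)
open Summit.QuantumFields.YangMills.Theorems.Prop8Chart (holT_gaugeActT)
open Summit.QuantumFields.Balaban3D.Carriers (radialHol radialHol_gaugeAct radialHol_one)
open BlockAveragingEMLLinearised (walkEnd_emb_stairWord_eq_blockSite)
open GaugeField (gaugeAct)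

variable {P : Params} {j : ℕ} {G : Type*} [GaugeGroup G]

/-! ## §1  The stair family of a block site -/

variable (P) in
/-- An enumeration of the `d!` orderings of the axes by `Fin ((d! − 1) + 1)` (the index type of `Setup.GroupAverage.M`). [cite: Balaban1987RG1, (0.3) p.252] -/
def permEnum : Fin ((Nat.factorial P.d - 1) + 1) ≃ Equiv.Perm (Fin P.d) :=
  (finCongr (Nat.sub_add_cancel (Nat.succ_le_of_lt (Nat.factorial_pos P.d)))).trans
    (Fintype.equivFinOfCardEq (by rw [Fintype.card_perm, Fintype.card_fin])).symm

/-- **THE STAIR FAMILY `{U(Γ^σ_{y,x})}_σ` OF [I] (0.3)∕(0.11)** at the block site `x = blockSite y r`: the transporters of `U` along the `d!` shortest staircases from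
the centre `emb y` to `x`, indexed through `permEnum`. [cite: Balaban1987RG1, (0.3) p.252, (0.11) p.253] -/
def stairFamily (U : GaugeField P j G) (y : Site P (j + 1)) (r : Fin P.d → Fin P.L) : Fin ((Nat.factorial P.d - 1) + 1) → G :=
  fun i => holT U (emb y) (stairWord (permEnum P i) (off r))

/-- Every member of the stair family of `U^u` is `u(emb y) · (member of U) · u(x)⁻¹`, `x = blockSite y r` ([3] (11)-type covariance of transporters; the stairs all END
at `x`, `walkEnd_emb_stairWord_eq_blockSite`). [cite: Balaban1985Averaging, (11) p.19; Balaban1987RG1, (0.3) p.252] -/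
theorem stairFamily_gaugeAct (u : GaugeTransf P j G) (U : GaugeField P j G) (y : Site P (j + 1)) (r : Fin P.d → Fin P.L) :
    stairFamily (gaugeAct u U) y r = fun i => u (emb y) * stairFamily U y r i * (u (Site.blockSite y r))⁻¹ := by
  funext i
  unfold stairFamily
  rw [← gaugeActT_eq_gaugeAct, holT_gaugeActT, walkEnd_emb_stairWord_eq_blockSite]

/-- The small-diameter guard is GAUGE INVARIANT: `U(Γ^σ)·U(Γ^τ)⁻¹ ↦ u(emb y)·(U(Γ^σ)·U(Γ^τ)⁻¹)·u(emb y)⁻¹` and `dist1` is conjugation invariant.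
[cite: Balaban1987RG1, (0.5)–(0.7) p.253] -/
theorem familySmall_stairFamily_gaugeAct_iff (δ : ℝ) (u : GaugeTransf P j G) (U : GaugeField P j G) (y : Site P (j + 1)) (r : Fin P.d → Fin P.L) :
    FamilySmall δ (stairFamily (gaugeAct u U) y r) ↔ FamilySmall δ (stairFamily U y r) := by
  rw [stairFamily_gaugeAct]
  unfold FamilySmall
  have key : ∀ i k, dist1 (u (emb y) * stairFamily U y r i * (u (Site.blockSite y r))⁻¹ *
      (u (emb y) * stairFamily U y r k * (u (Site.blockSite y r))⁻¹)⁻¹) = dist1 (stairFamily U y r i * (stairFamily U y r k)⁻¹) := by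
    intro i k
    have h : u (emb y) * stairFamily U y r i * (u (Site.blockSite y r))⁻¹ * (u (emb y) * stairFamily U y r k * (u (Site.blockSite y r))⁻¹)⁻¹ =
        u (emb y) * (stairFamily U y r i * (stairFamily U y r k)⁻¹) * (u (emb y))⁻¹ := by group
    rw [h, GaugeGroup.dist1_conj]
  simp only [key]

/-! ## §2  The (0.11) contour datum -/

/-- **[I] (0.11) — THE AVERAGED CONTOUR VARIABLE `𝐔(y, x) = M({U(Γ)}_{Γ∈G(y,x)})` AS A `Setup.ContourData`**, for a group average `𝓜` ((0.5)–(0.7) on `𝓜.δ`-small families):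
at `x ∈ B(y)` (standing range) with a `𝓜.δ`-small stair family, `𝓜.M` of the family; otherwise the radial transporter `U(Γ_{y,x})`.  Exactly gauge covariant (the guard is gauge
invariant and both branches transform as `u(emb y) · _ · u(x)⁻¹`). [cite: Balaban1987RG1, (0.11) p.253, (0.6) p.253; Balaban1985Averaging, (11) p.19] -/
def symContourData (𝓜 : GroupAverage G) : ContourData P j G where
  holTo U y x :=
    if hjx : j + 1 ≤ P.m + P.K ∧ blockOf x = y then
      @dite _ (FamilySmall 𝓜.δ (stairFamily U y (Site.blockEquiv hjx.1 y ⟨x, hjx.2⟩))) (Classical.dec _)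
        (fun _ => 𝓜.M (stairFamily U y (Site.blockEquiv hjx.1 y ⟨x, hjx.2⟩))) (fun _ => radialHol U y x)
    else radialHol U y x
  covariant u U y x := by
    by_cases hjx : j + 1 ≤ P.m + P.K ∧ blockOf x = y
    · simp only [hjx, and_self, ↓reduceDIte]
      have hxr : Site.blockSite y (Site.blockEquiv hjx.1 y ⟨x, hjx.2⟩) = x :=
        congrArg Subtype.val ((Site.blockEquiv hjx.1 y).symm_apply_apply ⟨x, hjx.2⟩)
      by_cases hs : FamilySmall 𝓜.δ (stairFamily U y (Site.blockEquiv hjx.1 y ⟨x, hjx.2⟩))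
      · have hs' : FamilySmall 𝓜.δ (stairFamily (gaugeAct u U) y (Site.blockEquiv hjx.1 y ⟨x, hjx.2⟩)) :=
          (familySmall_stairFamily_gaugeAct_iff 𝓜.δ u U y _).2 hs
        rw [dif_pos hs', dif_pos hs, stairFamily_gaugeAct, 𝓜.equivariant _ hs, hxr]
      · have hs' : ¬ FamilySmall 𝓜.δ (stairFamily (gaugeAct u U) y (Site.blockEquiv hjx.1 y ⟨x, hjx.2⟩)) :=
          fun h => hs ((familySmall_stairFamily_gaugeAct_iff 𝓜.δ u U y _).1 h)
        rw [dif_neg hs', dif_neg hs]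
        exact radialHol_gaugeAct u U y x
    · simp only [hjx, ↓reduceDIte]
      exact radialHol_gaugeAct u U y x

/-- The (0.11) branch: at a block site with a small stair family the datum is the group average of the family. [cite: Balaban1987RG1, (0.11) p.253] -/
theorem symContourData_holTo_of_small (𝓜 : GroupAverage G) (hj : j + 1 ≤ P.m + P.K) (U : GaugeField P j G) (y : Site P (j + 1)) (r : Fin P.d → Fin P.L)
    (hs : FamilySmall 𝓜.δ (stairFamily U y r)) :
    (symContourData 𝓜).holTo U y (Site.blockSite y r) = 𝓜.M (stairFamily U y r) := by
  have hx : blockOf (Site.blockSite y r) = y := Site.blockOf_blockSite hj y r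
  have hjx : j + 1 ≤ P.m + P.K ∧ blockOf (Site.blockSite y r) = y := ⟨hj, hx⟩
  have hr : Site.blockEquiv hj y ⟨Site.blockSite y r, hx⟩ = r := (Site.blockEquiv hj y).apply_symm_apply r
  show (if hjx : j + 1 ≤ P.m + P.K ∧ blockOf (Site.blockSite y r) = y then _ else _) = _
  rw [dif_pos hjx, hr, dif_pos hs]

/-- Off the block the datum is the radial transporter. [cite: Balaban1984PropagatorsI, (1.7) p.18] -/
theorem symContourData_holTo_of_not_mem (𝓜 : GroupAverage G) (U : GaugeField P j G) {y : Site P (j + 1)} {x : Site P j} (hx : blockOf x ≠ y) :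
    (symContourData 𝓜).holTo U y x = radialHol U y x := by
  show (if hjx : j + 1 ≤ P.m + P.K ∧ blockOf x = y then _ else _) = _
  rw [dif_neg (fun h => hx h.2)]

/-- At a block site with a LARGE stair family the datum is the radial transporter. [cite: Balaban1984PropagatorsI, (1.7) p.18] -/
theorem symContourData_holTo_of_not_small (𝓜 : GroupAverage G) (hj : j + 1 ≤ P.m + P.K) (U : GaugeField P j G) (y : Site P (j + 1)) (r : Fin P.d → Fin P.L)
    (hs : ¬ FamilySmall 𝓜.δ (stairFamily U y r)) :
    (symContourData 𝓜).holTo U y (Site.blockSite y r) = radialHol U y (Site.blockSite y r) := by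
  have hx : blockOf (Site.blockSite y r) = y := Site.blockOf_blockSite hj y r
  have hjx : j + 1 ≤ P.m + P.K ∧ blockOf (Site.blockSite y r) = y := ⟨hj, hx⟩
  have hr : Site.blockEquiv hj y ⟨Site.blockSite y r, hx⟩ = r := (Site.blockEquiv hj y).apply_symm_apply r
  show (if hjx : j + 1 ≤ P.m + P.K ∧ blockOf (Site.blockSite y r) = y then _ else _) = _
  rw [dif_pos hjx, hr, dif_neg hs]

/-- Off the standing range (junk levels `j + 1 > m + K`) the datum is the radial transporter everywhere. [cite: Balaban1984PropagatorsI, (1.7) p.18] -/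
theorem symContourData_holTo_of_not_range (𝓜 : GroupAverage G) (hj : ¬ j + 1 ≤ P.m + P.K) (U : GaugeField P j G) (y : Site P (j + 1)) (x : Site P j) :
    (symContourData 𝓜).holTo U y x = radialHol U y x := by
  show (if hjx : j + 1 ≤ P.m + P.K ∧ blockOf x = y then _ else _) = _
  rw [dif_neg (fun h => hj h.1)]

/-! ## §3  The centre value (`hctr` of `Node00/ShearedAveragingFlat`) -/

/-- The centre `emb y` is the block site of the centred offset, whose `off` vanishes. [cite: Balaban1987RG1, (0.3) p.252] -/
theorem off_blockEquiv_emb (hj : j + 1 ≤ P.m + P.K) (y : Site P (j + 1)) :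
    off (Site.blockEquiv hj y ⟨emb y, Site.blockOf_emb hj y⟩) = 0 := by
  funext ν
  have hL : (P.L - 1) / 2 < P.L := by have := P.L_pos; omega
  have hval : ((Site.blockEquiv hj y ⟨emb y, Site.blockOf_emb hj y⟩ ν : Fin P.L) : ℕ) = (P.L - 1) / 2 := by
    show ((emb y) ν).val % P.L = (P.L - 1) / 2
    rw [Site.val_emb hj, Nat.mul_add_mod', Nat.mod_eq_of_lt hL]
  simp only [off, hval, Pi.zero_apply, sub_self]

/-- At the centre the stair family is constantly `1` (empty staircases). [cite: Balaban1987RG1, (0.3) p.252] -/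
theorem stairFamily_emb (hj : j + 1 ≤ P.m + P.K) (U : GaugeField P j G) (y : Site P (j + 1)) :
    stairFamily U y (Site.blockEquiv hj y ⟨emb y, Site.blockOf_emb hj y⟩) = fun _ => 1 := by
  funext i
  unfold stairFamily
  -- the staircase of the zero offset is the empty word (the tree's `…Spine.NE7.stairWord_zero`, re-derived inline to keep this leaf's imports light)
  have hzero : ∀ σ : Equiv.Perm (Fin P.d), stairWord σ (0 : Fin P.d → ℤ) = [] := fun σ => by
    unfold stairWord
    induction (List.finRange P.d).map σ with
    | nil => rfl
    | cons a as ih =>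
      simp only [T4Continuum.stairRuns, T4Continuum.axisRun, Pi.zero_apply, Int.natAbs_zero, List.replicate_zero, List.nil_append]
      exact ih
  rw [off_blockEquiv_emb hj y, hzero, B10Eq27TorusAxialLog.holT_nil]

/-- **THE CENTRE VALUE**: in the standing range, `𝐔(y, emb y) = 𝓜.M (const 1)` (the constant family is `𝓜.δ`-small: `dist1 1 = 0`).  For a group average with
`M(const g) = g` this is `1` — the hypothesis `hctr` of `Node00/ShearedAveragingFlat`'s (82)–(88). [cite: Balaban1987RG1, (0.11) p.253; Balaban1985Averaging, (82) p.30] -/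
theorem symContourData_holTo_emb (𝓜 : GroupAverage G) (hj : j + 1 ≤ P.m + P.K) (U : GaugeField P j G) (y : Site P (j + 1))
    (hconst : 𝓜.M (fun _ : Fin ((Nat.factorial P.d - 1) + 1) => (1 : G)) = 1) :
    (symContourData 𝓜).holTo U y (emb y) = 1 := by
  have hx : blockOf (emb y) = y := Site.blockOf_emb hj y
  have hjx : j + 1 ≤ P.m + P.K ∧ blockOf (emb y) = y := ⟨hj, hx⟩
  have hfam : stairFamily U y (Site.blockEquiv hj y ⟨emb y, hx⟩) = fun _ => 1 := stairFamily_emb hj U y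
  have hs : FamilySmall 𝓜.δ (stairFamily U y (Site.blockEquiv hj y ⟨emb y, hx⟩)) := by
    rw [hfam]
    intro i k
    rw [mul_inv_cancel, GaugeGroup.dist1_one]
    exact 𝓜.δ_pos
  show (if hjx : j + 1 ≤ P.m + P.K ∧ blockOf (emb y) = y then _ else _) = _
  rw [dif_pos hjx, dif_pos hs, hfam, hconst]

/-- The `SU(N)` instance of record: with Federbush's mean (0.10) (`FederbushMean.federbushSU`, radius `min(1∕100, 1∕(3N))`) the centre value is `1` at every
level of the standing range — `hctr` for `symContourData federbushSU`. [cite: Balaban1987RG1, (0.10)–(0.11) p.253] -/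
theorem symContourData_federbushSU_holTo_emb {N : ℕ} [NeZero N] (hj : j + 1 ≤ P.m + P.K)
    (U : GaugeField P j (Matrix.specialUnitaryGroup (Fin N) ℂ)) (y : Site P (j + 1)) :
    (symContourData (FederbushMean.federbushSU (n := Fin N))).holTo U y (emb y) = 1 :=
  symContourData_holTo_emb _ hj U y (FederbushMean.federbushSU_const 1)

/-! ## §4  The unit configuration (A6 material) -/

/-- The stair family of the unit configuration is constantly `1`. [cite: Balaban1987RG1, (0.3) p.252 (bookkeeping)] -/
theorem stairFamily_one (y : Site P (j + 1)) (r : Fin P.d → Fin P.L) : stairFamily (1 : GaugeField P j G) y r = fun _ => 1 := by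
  funext i
  exact B10Eq27TorusAxialLog.holT_one _ _

/-- **THE AVERAGED CONTOUR VARIABLES OF THE UNIT CONFIGURATION ARE `1`** (for a group average with `M(const 1) = 1`): on the block by `𝓜.M (const 1)`, off it by `radialHol_one`.
[cite: Balaban1987RG1, (0.11) p.253 (bookkeeping)] -/
theorem symContourData_holTo_one (𝓜 : GroupAverage G) (hconst : 𝓜.M (fun _ : Fin ((Nat.factorial P.d - 1) + 1) => (1 : G)) = 1)
    (y : Site P (j + 1)) (x : Site P j) : (symContourData 𝓜).holTo (1 : GaugeField P j G) y x = 1 := by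
  by_cases hjx : j + 1 ≤ P.m + P.K ∧ blockOf x = y
  · have hfam : stairFamily (1 : GaugeField P j G) y (Site.blockEquiv hjx.1 y ⟨x, hjx.2⟩) = fun _ => 1 := stairFamily_one y _
    have hs : FamilySmall 𝓜.δ (stairFamily (1 : GaugeField P j G) y (Site.blockEquiv hjx.1 y ⟨x, hjx.2⟩)) := by
      rw [hfam]
      intro i k
      rw [mul_inv_cancel, GaugeGroup.dist1_one]
      exact 𝓜.δ_pos
    show (if hjx : j + 1 ≤ P.m + P.K ∧ blockOf x = y then _ else _) = _
    rw [dif_pos hjx, dif_pos hs, hfam, hconst]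
  · show (if hjx : j + 1 ≤ P.m + P.K ∧ blockOf x = y then _ else _) = _
    rw [dif_neg hjx]
    exact radialHol_one y x

/-- **THE UNIT CONFIGURATION IS `symContourData`-AXIAL** (A6 witness for the representative clause of the normalisation predicates). [cite: Balaban1987RG1, (0.11) p.253; Balaban1985RegularSpaces, (1.15) p.78 (bookkeeping)] -/
theorem axialGauge_symContourData_one (𝓜 : GroupAverage G) (hconst : 𝓜.M (fun _ : Fin ((Nat.factorial P.d - 1) + 1) => (1 : G)) = 1) :
    AxialGauge (symContourData 𝓜) (1 : GaugeField P j G) :=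
  fun y x _ _ => symContourData_holTo_one 𝓜 hconst y x

end Summit.QuantumFields.YangMills.BalabanUVNodes.N07SymContourData

end
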